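import Summits.CriticalPhenomena.PercolationContinuityZ3.Theorems.PercNearOneGluingNoHeavyPcintMemUniform
import HarnessLib

/-!
# CriticalPhenomena/PercolationContinuityZ3 — Theorems/PercNearOneGluingNoHeavyPcintMemUniformBounds.lean: Collatz–Wielandt with REAL, `d`-dependent row weights on the uniform class automaton ⇒ `λ ≤ μ_τ(ℤ^d) ≤ λ'` for every `d ≥ 4` from ONE dimension-4 row list

Lane prim-pcint, STRUCTURE rule (prim-pcint-2 GEN 18), companion of …PcintMemUniform (`cnt_mstep_eq_cnt_uistep`: for `d ≥ 4` the
memory-`τ` counts of `ℤ^d` are the accepted-word counts of the uniform index automaton `uistep L d` of a dimension-4 row list).  Here: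

* `optValR`, **`cnt_le_of_realCert`** / **`cnt_ge_of_realSubcert`** — the Collatz–Wielandt counting bounds for an index automaton with
  REAL weights (`Σ_a w(succ_a i) ≤ λ w_i ⇒ m·#words_n(i) ≤ λⁿ w_i`, and dually), so that weights may be rational functions of `d`;
* **`sum_uistep`** — the row sums of `uistep L d` over the `2d` letters of `ℤ^d` split as
  `Σ_{a ∈ Fin 4 × Bool} w(succ_a i) + (d − 4) · Σ_{b ∈ Bool} w(succ_{(3,b)} i)` (letters on axes `≥ 4` act like axis `3`);
* `memGrowth_le_of_geometric` (`c_{n,τ} ≤ C λⁿ ⇒ μ_τ ≤ λ`, via `μ_τ ≤ c_n^{1/n}` and `C^{1/n} → 1`);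
* **`memGrowth_le_of_ucert`** / **`le_memGrowth_of_ucert`**: for `d ≥ 4`, a structurally valid (`UStruct`) row list supported off
  axis 3 (`USupp`) and positive row weights `w_i` with `base_i(w) + (d−4)·fresh_i(w) ≤ λ w_i` for every row (resp. `≥`) give
  `μ_τ(ℤ^d) ≤ λ` (resp. `λ ≤ μ_τ(ℤ^d)`).  The row obligations are finitely many LINEAR inequalities whose coefficients are affine in
  `d`; …PcintMemUniformSix discharges them for the 25-row memory-6 list with weights polynomial in `d` (all `d ≥ 4` at once) and with
  numeral weights (single `d`).

HONEST FRAMING: bookkeeping (Collatz–Wielandt / Fekete); no certificate is run here.  No `sorry`; standard axioms.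
Written by prim-pcint-2 gen 18 (prover-prim-pcint-2-g18-0), 2026-08-26.
-/

noncomputable section

open Filter Topology
open Literature.Probability.Percolation Literature.Probability.LatticeModels

namespace Summit.CriticalPhenomena.PercolationContinuityZ3.Theorems.Pcint

/-! ### Collatz–Wielandt with real weights on an index automaton -/

section RealCW

/-- Value of a real weight at an optional index (`0` at `none`). [folklore] -/
def optValR (w : ℕ → ℝ) : Option ℕ → ℝ
  | none => 0
  | some j => w j

/-- `optValR` at `none`. [folklore] -/
@[simp] theorem optValR_none (w : ℕ → ℝ) : optValR w none = 0 := rfl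

/-- `optValR` at `some`. [folklore] -/
@[simp] theorem optValR_some (w : ℕ → ℝ) (j : ℕ) : optValR w (some j) = w j := rfl

/-- One step of the first-letter recursion of `cnt`, in `ℝ`. [folklore] -/
theorem cnt_succ_real {α : Type*} [Fintype α] (step : ℕ → α → Option ℕ) (i n : ℕ) :
    (cnt step i (n + 1) : ℝ) = ∑ a, optValR (fun j => (cnt step j n : ℝ)) (step i a) := by
  simp only [cnt, Nat.cast_sum]
  refine Finset.sum_congr rfl fun a _ => ?_
  cases step i a <;> simp

/-- **Collatz–Wielandt, real weights (upper)**: `m · #words_n(i) ≤ λⁿ · w_i` on a closed set of indices. [folklore] -/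
theorem cnt_le_of_realCert {α : Type*} [Fintype α] (step : ℕ → α → Option ℕ) (R : Set ℕ)
    (hR : ∀ i ∈ R, ∀ a j, step i a = some j → j ∈ R) (w : ℕ → ℝ) (lam m : ℝ) (hlam : 0 ≤ lam)
    (hm : ∀ i ∈ R, m ≤ w i) (hrow : ∀ i ∈ R, ∑ a, optValR w (step i a) ≤ lam * w i) :
    ∀ (n : ℕ), ∀ i ∈ R, m * cnt step i n ≤ lam ^ n * w i := by
  intro n
  induction n with
  | zero => intro i hi; simpa [cnt] using hm i hi
  | succ n ih =>
    intro i hi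
    rw [cnt_succ_real, Finset.mul_sum]
    calc ∑ a, m * optValR (fun j => (cnt step j n : ℝ)) (step i a)
        ≤ ∑ a, lam ^ n * optValR w (step i a) := by
          refine Finset.sum_le_sum fun a _ => ?_
          cases hia : step i a with
          | none => simp
          | some j => simpa using ih j (hR i hi a j hia)
      _ = lam ^ n * ∑ a, optValR w (step i a) := by rw [Finset.mul_sum]
      _ ≤ lam ^ n * (lam * w i) := mul_le_mul_of_nonneg_left (hrow i hi) (pow_nonneg hlam n)
      _ = lam ^ (n + 1) * w i := by rw [pow_succ]; ring

/-- **Collatz–Wielandt, real weights (lower)**: `λⁿ · w_i ≤ M · #words_n(i)` on a closed set of indices. [folklore] -/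
theorem cnt_ge_of_realSubcert {α : Type*} [Fintype α] (step : ℕ → α → Option ℕ) (R : Set ℕ)
    (hR : ∀ i ∈ R, ∀ a j, step i a = some j → j ∈ R) (w : ℕ → ℝ) (lam M : ℝ) (hlam : 0 ≤ lam)
    (hM : ∀ i ∈ R, w i ≤ M) (hrow : ∀ i ∈ R, lam * w i ≤ ∑ a, optValR w (step i a)) :
    ∀ (n : ℕ), ∀ i ∈ R, lam ^ n * w i ≤ M * cnt step i n := by
  intro n
  induction n with
  | zero => intro i hi; simpa [cnt] using hM i hi
  | succ n ih =>
    intro i hi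
    rw [cnt_succ_real, Finset.mul_sum]
    calc lam ^ (n + 1) * w i = lam ^ n * (lam * w i) := by rw [pow_succ]; ring
      _ ≤ lam ^ n * ∑ a, optValR w (step i a) := mul_le_mul_of_nonneg_left (hrow i hi) (pow_nonneg hlam n)
      _ = ∑ a, lam ^ n * optValR w (step i a) := by rw [Finset.mul_sum]
      _ ≤ ∑ a, M * optValR (fun j => (cnt step j n : ℝ)) (step i a) := by
          refine Finset.sum_le_sum fun a _ => ?_
          cases hia : step i a with
          | none => simp
          | some j => simpa using ih j (hR i hi a j hia)

end RealCW

/-! ### Row sums of the uniform index automaton -/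

section RowSum

variable {d : ℕ}

/-- The base part of a row sum: the eight letters of `ℤ⁴`. [folklore] -/
def baseSum (L : List (SCertRow 4)) (w : ℕ → ℝ) (i : ℕ) : ℝ := ∑ a : Fin 4 × Bool, optValR w (sistep L i a)

/-- The fresh part of a row sum: the two letters of axis `3`. [folklore] -/
def freshSum (L : List (SCertRow 4)) (w : ℕ → ℝ) (i : ℕ) : ℝ := ∑ b : Bool, optValR w (sistep L i ((3 : Fin 4), b))

/-- **Row sums in dimension `d`**: `Σ_{a ∈ letters of ℤ^d} w(succ_a i) = base_i(w) + (d − 4) · fresh_i(w)` for `d ≥ 4`. [folklore] -/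
theorem sum_uistep (L : List (SCertRow 4)) (hd : 4 ≤ d) (w : ℕ → ℝ) (i : ℕ) :
    ∑ a : Fin d × Bool, optValR w (uistep L d i a) = baseSum L w i + ((d : ℝ) - 4) * freshSum L w i := by
  -- per sign `b`, sum over the axis as a natural number
  let g : Bool → ℕ → ℝ := fun b j =>
    if h : j < 4 then optValR w (sistep L i (⟨j, h⟩, b)) else optValR w (sistep L i ((3 : Fin 4), b))
  have hpt : ∀ (b : Bool) (j : Fin d), optValR w (uistep L d i (j, b)) = g b j := by
    intro b j
    by_cases h : (j : ℕ) < 4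
    · simp [uistep, g, h]
    · simp [uistep, g, h]
  have haxis : ∀ b : Bool, ∑ j : Fin d, optValR w (uistep L d i (j, b)) =
      ∑ j : Fin 4, optValR w (sistep L i (j, b)) + ((d : ℝ) - 4) * optValR w (sistep L i ((3 : Fin 4), b)) := by
    intro b
    have h1 : ∑ j : Fin d, optValR w (uistep L d i (j, b)) = ∑ j ∈ Finset.range d, g b j := by
      rw [← Fin.sum_univ_eq_sum_range (fun j => g b j) d]
      exact Finset.sum_congr rfl fun j _ => hpt b j
    have h2 : ∑ j : Fin 4, optValR w (sistep L i (j, b)) = ∑ j ∈ Finset.range 4, g b j := by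
      rw [← Fin.sum_univ_eq_sum_range (fun j => g b j) 4]
      refine Finset.sum_congr rfl fun j _ => ?_
      simp [g, j.isLt]
    have h3 : ∑ j ∈ Finset.Ico 4 d, g b j = ((d : ℝ) - 4) * optValR w (sistep L i ((3 : Fin 4), b)) := by
      rw [Finset.sum_congr rfl (fun j hj => by
        have hj4 : ¬ j < 4 := by simp [Finset.mem_Ico] at hj; omega
        show g b j = optValR w (sistep L i ((3 : Fin 4), b))
        simp [g, hj4])]
      rw [Finset.sum_const, Nat.card_Ico, nsmul_eq_mul]
      congr 1
      rw [Nat.cast_sub hd]; norm_num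
    rw [h1, h2, ← h3, Finset.range_eq_Ico, Finset.range_eq_Ico]
    exact (Finset.sum_Ico_consecutive _ (Nat.zero_le 4) hd).symm
  rw [Fintype.sum_prod_type_right]
  simp only [haxis, Finset.sum_add_distrib, ← Finset.mul_sum]
  unfold baseSum freshSum
  rw [Fintype.sum_prod_type_right]

/-- The eight letters of `ℤ⁴` in the fixed order `(0,+), (0,−), (1,+), …, (3,−)`. [folklore] -/
def lettersFour : List (Fin 4 × Bool) :=
  [(0, true), (0, false), (1, true), (1, false), (2, true), (2, false), (3, true), (3, false)]

/-- Successor indices of row `i` over the eight letters of `ℤ⁴` (computable table). [folklore] -/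
def baseIdx (L : List (SCertRow 4)) (i : ℕ) : List (Option ℕ) := lettersFour.map (sistep L i)

/-- Successor indices of row `i` over the two letters of axis `3`. [folklore] -/
def freshIdx (L : List (SCertRow 4)) (i : ℕ) : List (Option ℕ) :=
  [sistep L i ((3 : Fin 4), true), sistep L i ((3 : Fin 4), false)]

/-- The base sum as a list sum over the successor table. [folklore] -/
theorem baseSum_eq (L : List (SCertRow 4)) (w : ℕ → ℝ) (i : ℕ) :
    baseSum L w i = ((baseIdx L i).map (optValR w)).sum := by
  simp only [baseSum, Fintype.sum_prod_type, Fin.sum_univ_four, Fintype.sum_bool, baseIdx, lettersFour, List.map,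
    List.sum_cons, List.sum_nil]
  ring

/-- The fresh sum as a list sum over the successor table. [folklore] -/
theorem freshSum_eq (L : List (SCertRow 4)) (w : ℕ → ℝ) (i : ℕ) :
    freshSum L w i = ((freshIdx L i).map (optValR w)).sum := by
  simp only [freshSum, Fintype.sum_bool, freshIdx, List.map, List.sum_cons, List.sum_nil]
  ring

/-- One step of the first-letter recursion of `cntP` on the uniform index automaton, in `ℝ`:
`cntP_{n+1}(i) = base_i(cntP_n) + (d − 4)·fresh_i(cntP_n)` for `d ≥ 4`. [folklore] -/
theorem cntP_uistep_succ_real (L : List (SCertRow 4)) (hd : 4 ≤ d) (P : ℕ → Prop) [DecidablePred P] (i n : ℕ) :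
    (cntP (uistep L d) P i (n + 1) : ℝ) =
      baseSum L (fun j => (cntP (uistep L d) P j n : ℝ)) i +
        ((d : ℝ) - 4) * freshSum L (fun j => (cntP (uistep L d) P j n : ℝ)) i := by
  rw [← sum_uistep L hd]
  simp only [cntP, Nat.cast_sum]
  refine Finset.sum_congr rfl fun a _ => ?_
  cases uistep L d i a <;> simp

end RowSum

/-! ### The uniform certificates -/

section Bounds

variable {d : ℕ}

/-- **`c_{n,τ} ≤ C λⁿ` for all `n ≥ 1` implies `μ_τ ≤ λ`** (`μ_τ ≤ c_n^{1/n}` by submultiplicativity, `C^{1/n} → 1`).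
[cite: MadrasSlade1993, §1.2 (1.2.12)–(1.2.14)] -/
theorem memGrowth_le_of_geometric [NeZero d] {τ : ℕ} {C lam : ℝ} (hC : 0 < C) (hlam : 0 < lam)
    (h : ∀ n : ℕ, 1 ≤ n → (MemoryTail.memCount d τ n : ℝ) ≤ C * lam ^ n) : MemoryTail.memGrowth d τ ≤ lam := by
  have hlim : Tendsto (fun n : ℕ => C ^ (1 / (n : ℝ)) * lam) atTop (𝓝 lam) := by
    have := (Literature.Probability.RandomPlanarGeometry.SAW.HexBW.tendsto_const_rpow_one_div_nat₀ hC).mul_const lam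
    rwa [one_mul] at this
  refine ge_of_tendsto hlim (Filter.eventually_atTop.2 ⟨1, fun n hn => ?_⟩)
  have hn0 : (n : ℝ) ≠ 0 := by exact_mod_cast (show n ≠ 0 by omega)
  calc MemoryTail.memGrowth d τ ≤ (MemoryTail.memCount d τ n : ℝ) ^ (1 / (n : ℝ)) :=
        MemoryTail.memGrowth_le_rpow d τ (by omega)
    _ ≤ (C * lam ^ n) ^ (1 / (n : ℝ)) :=
        Real.rpow_le_rpow (Nat.cast_nonneg _) (h n hn) (by positivity)
    _ = C ^ (1 / (n : ℝ)) * lam := by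
        rw [Real.mul_rpow hC.le (pow_nonneg hlam.le n), ← Real.rpow_natCast, ← Real.rpow_mul hlam.le,
          mul_one_div_cancel hn0, Real.rpow_one]

/-- **Uniform UPPER certificate**: `μ_τ(ℤ^d) ≤ λ` for `d ≥ 4` from positive real row weights with
`base_i(w) + (d − 4)·fresh_i(w) ≤ λ·w_i` on every row of a structurally valid dimension-4 list supported off axis `3`.
[cite: PonitzTittmann2000, §3] -/
theorem memGrowth_le_of_ucert [NeZero d] {τ : ℕ} {L : List (SCertRow 4)} (hτ : 2 ≤ τ) (hd : 4 ≤ d)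
    (hU : UStruct τ L) (hS : USupp L) (w : ℕ → ℝ) (lam : ℝ) (hlam : 0 < lam)
    (hw : ∀ i < L.length, 0 < w i)
    (hrow : ∀ i < L.length, baseSum L w i + ((d : ℝ) - 4) * freshSum L w i ≤ lam * w i) :
    MemoryTail.memGrowth d τ ≤ lam := by
  have h0 : 0 < L.length := hU.1
  set R : Set ℕ := {i | i < L.length}
  have hR : ∀ i ∈ R, ∀ a j, uistep L d i a = some j → j ∈ R := by
    intro i hi a j hij
    unfold uistep sistep at hij
    split_ifs at hij with ha
    · cases hs : ssucc L i (⟨a.1, ha⟩, a.2) with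
      | none => rw [hs] at hij; exact absurd hij (by simp)
      | some p =>
        rw [hs, Option.map_some] at hij
        simp only [Option.some.injEq] at hij
        have := (hU.2.2 i hi _).2 p (by rw [hs]; simp)
        rw [hij] at this; exact this
    · cases hs : ssucc L i ((3 : Fin 4), a.2) with
      | none => rw [hs] at hij; exact absurd hij (by simp)
      | some p =>
        rw [hs, Option.map_some] at hij
        simp only [Option.some.injEq] at hij
        have := (hU.2.2 i hi _).2 p (by rw [hs]; simp)
        rw [hij] at this; exact this
  -- minimum weight
  obtain ⟨i₀, hi₀, hmin⟩ := (Finset.range L.length).exists_min_image w ⟨0, by simpa using h0⟩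
  set m := w i₀
  have hm : 0 < m := hw i₀ (by simpa using hi₀)
  have hmle : ∀ i ∈ R, m ≤ w i := fun i hi => hmin i (Finset.mem_range.2 hi)
  have hrow' : ∀ i ∈ R, ∑ a : Fin d × Bool, optValR w (uistep L d i a) ≤ lam * w i := by
    intro i hi; rw [sum_uistep L hd w i]; exact hrow i hi
  have hcw := cnt_le_of_realCert (uistep L d) R hR w lam m hlam.le hmle hrow'
  refine memGrowth_le_of_geometric (C := w 0 / m) (by have := hw 0 h0; positivity) hlam fun n _ => ?_
  have h1 := hcw n 0 h0
  rw [← cnt_mstep_eq_cnt_uistep hd hU hS n, cnt_mstep_empty_eq_memCount hτ] at h1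
  rw [div_mul_eq_mul_div, le_div_iff₀ hm]
  linarith

/-- **Uniform LOWER certificate**: `λ ≤ μ_τ(ℤ^d)` for `d ≥ 4` from positive real row weights with
`λ·w_i ≤ base_i(w) + (d − 4)·fresh_i(w)` on every row. [cite: PonitzTittmann2000, §3] -/
theorem le_memGrowth_of_ucert [NeZero d] {τ : ℕ} {L : List (SCertRow 4)} (hτ : 2 ≤ τ) (hd : 4 ≤ d)
    (hU : UStruct τ L) (hS : USupp L) (w : ℕ → ℝ) (lam : ℝ) (hlam : 0 < lam)
    (hw : ∀ i < L.length, 0 < w i)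
    (hrow : ∀ i < L.length, lam * w i ≤ baseSum L w i + ((d : ℝ) - 4) * freshSum L w i) :
    lam ≤ MemoryTail.memGrowth d τ := by
  have h0 : 0 < L.length := hU.1
  set R : Set ℕ := {i | i < L.length}
  have hR : ∀ i ∈ R, ∀ a j, uistep L d i a = some j → j ∈ R := by
    intro i hi a j hij
    unfold uistep sistep at hij
    split_ifs at hij with ha
    · cases hs : ssucc L i (⟨a.1, ha⟩, a.2) with
      | none => rw [hs] at hij; exact absurd hij (by simp)
      | some p =>
        rw [hs, Option.map_some] at hij
        simp only [Option.some.injEq] at hij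
        have := (hU.2.2 i hi _).2 p (by rw [hs]; simp)
        rw [hij] at this; exact this
    · cases hs : ssucc L i ((3 : Fin 4), a.2) with
      | none => rw [hs] at hij; exact absurd hij (by simp)
      | some p =>
        rw [hs, Option.map_some] at hij
        simp only [Option.some.injEq] at hij
        have := (hU.2.2 i hi _).2 p (by rw [hs]; simp)
        rw [hij] at this; exact this
  -- maximum weight
  obtain ⟨i₁, hi₁, hmax⟩ := (Finset.range L.length).exists_max_image w ⟨0, by simpa using h0⟩
  set M := w i₁
  have hM : 0 < M := hw i₁ (by simpa using hi₁)
  have hMle : ∀ i ∈ R, w i ≤ M := fun i hi => hmax i (Finset.mem_range.2 hi)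
  have hrow' : ∀ i ∈ R, lam * w i ≤ ∑ a : Fin d × Bool, optValR w (uistep L d i a) := by
    intro i hi; rw [sum_uistep L hd w i]; exact hrow i hi
  have hcw := cnt_ge_of_realSubcert (uistep L d) R hR w lam M hlam.le hMle hrow'
  have hw0 := hw 0 h0
  refine le_memGrowth_of_geometric_le (K := M / w 0) (ρ := lam) (by positivity) hlam fun n _ => ?_
  have h1 := hcw n 0 h0
  rw [← cnt_mstep_eq_cnt_uistep hd hU hS n, cnt_mstep_empty_eq_memCount hτ] at h1
  rw [div_le_iff₀ (by positivity)]
  calc lam ^ n ≤ M * (MemoryTail.memCount d τ n : ℝ) / w 0 := by rw [le_div_iff₀ hw0]; linarith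
    _ = (MemoryTail.memCount d τ n : ℝ) * (M / w 0) := by ring

/-! ### Numeral certificates for a single dimension (decidable) -/

/-- Base part of a row sum with natural-number weights `V` (a list, default `0`). [folklore] -/
def baseSumN (L : List (SCertRow 4)) (V : List ℕ) (i : ℕ) : ℕ :=
  ∑ a : Fin 4 × Bool, optVal (fun j => V.getD j 0) (sistep L i a)

/-- Fresh part of a row sum with natural-number weights. [folklore] -/
def freshSumN (L : List (SCertRow 4)) (V : List ℕ) (i : ℕ) : ℕ :=
  ∑ b : Bool, optVal (fun j => V.getD j 0) (sistep L i ((3 : Fin 4), b))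

/-- **Validity of a two-sided numeral certificate in dimension `d`** on the rows of a dimension-4 list: positive weights and
`num_lo · V_i ≤ den · (base_i + (d−4) fresh_i) ≤ num_hi · V_i` for every row.  Decidable. [folklore] -/
def UNumOK (L : List (SCertRow 4)) (d numHi numLo den : ℕ) (V : List ℕ) : Prop :=
  ∀ i < L.length, 0 < V.getD i 0 ∧
    den * (baseSumN L V i + (d - 4) * freshSumN L V i) ≤ numHi * V.getD i 0 ∧
      numLo * V.getD i 0 ≤ den * (baseSumN L V i + (d - 4) * freshSumN L V i)

/-- `UNumOK` is decidable. [folklore] -/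
instance (L : List (SCertRow 4)) (d numHi numLo den : ℕ) (V : List ℕ) : Decidable (UNumOK L d numHi numLo den V) := by
  unfold UNumOK; infer_instance

/-- Casting `optVal` to `ℝ`. [folklore] -/
theorem cast_optVal (V : ℕ → ℕ) (o : Option ℕ) : ((optVal V o : ℕ) : ℝ) = optValR (fun j => (V j : ℝ)) o := by
  cases o <;> simp

/-- Casting the base sum to `ℝ`. [folklore] -/
theorem cast_baseSumN (L : List (SCertRow 4)) (V : List ℕ) (i : ℕ) :
    ((baseSumN L V i : ℕ) : ℝ) = baseSum L (fun j => (V.getD j 0 : ℝ)) i := by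
  simp [baseSumN, baseSum, cast_optVal]

/-- Casting the fresh sum to `ℝ`. [folklore] -/
theorem cast_freshSumN (L : List (SCertRow 4)) (V : List ℕ) (i : ℕ) :
    ((freshSumN L V i : ℕ) : ℝ) = freshSum L (fun j => (V.getD j 0 : ℝ)) i := by
  simp [freshSumN, freshSum, cast_optVal]

/-- **Two-sided bound from a numeral certificate**: `num_lo/den ≤ μ_τ(ℤ^d) ≤ num_hi/den` (`d ≥ 4`, `den > 0`, `num_lo > 0`).
[cite: PonitzTittmann2000, §3] -/
theorem memGrowth_mem_Icc_of_unum [NeZero d] {τ : ℕ} {L : List (SCertRow 4)} (hτ : 2 ≤ τ) (hd : 4 ≤ d)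
    (hU : UStruct τ L) (hS : USupp L) {numHi numLo den : ℕ} {V : List ℕ} (hden : 0 < den) (hlo : 0 < numLo)
    (h : UNumOK L d numHi numLo den V) :
    (numLo : ℝ) / den ≤ MemoryTail.memGrowth d τ ∧ MemoryTail.memGrowth d τ ≤ (numHi : ℝ) / den := by
  set w : ℕ → ℝ := fun j => (V.getD j 0 : ℝ)
  have hw : ∀ i < L.length, 0 < w i := fun i hi => by
    show (0 : ℝ) < ((V.getD i 0 : ℕ) : ℝ)
    exact_mod_cast (h i hi).1
  have hdenR : (0 : ℝ) < den := by exact_mod_cast hden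
  have hd4 : ((d - 4 : ℕ) : ℝ) = (d : ℝ) - 4 := by rw [Nat.cast_sub hd]; norm_num
  have hrowR : ∀ i < L.length,
      (numLo : ℝ) * w i ≤ (den : ℝ) * (baseSum L w i + ((d : ℝ) - 4) * freshSum L w i) ∧
        (den : ℝ) * (baseSum L w i + ((d : ℝ) - 4) * freshSum L w i) ≤ (numHi : ℝ) * w i := by
    intro i hi
    obtain ⟨-, h1, h2⟩ := h i hi
    have h1' : ((den * (baseSumN L V i + (d - 4) * freshSumN L V i) : ℕ) : ℝ) ≤ ((numHi * V.getD i 0 : ℕ) : ℝ) := by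
      exact_mod_cast h1
    have h2' : ((numLo * V.getD i 0 : ℕ) : ℝ) ≤ ((den * (baseSumN L V i + (d - 4) * freshSumN L V i) : ℕ) : ℝ) := by
      exact_mod_cast h2
    simp only [Nat.cast_mul, Nat.cast_add, hd4, cast_baseSumN, cast_freshSumN] at h1' h2'
    exact ⟨h2', h1'⟩
  have hloR : (0 : ℝ) < numLo := by exact_mod_cast hlo
  have hhiR : (0 : ℝ) < numHi := by
    have h0 := hU.1
    obtain ⟨h2, h1⟩ := hrowR 0 h0
    have hw0 := hw 0 h0
    have : (0 : ℝ) < (numHi : ℝ) * w 0 := by nlinarith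
    by_contra hc
    push Not at hc
    nlinarith
  constructor
  · refine le_memGrowth_of_ucert hτ hd hU hS w _ (div_pos hloR hdenR) hw fun i hi => ?_
    have := (hrowR i hi).1
    rw [div_mul_eq_mul_div, div_le_iff₀ hdenR]
    linarith
  · refine memGrowth_le_of_ucert hτ hd hU hS w _ (div_pos hhiR hdenR) hw fun i hi => ?_
    have := (hrowR i hi).2
    rw [div_mul_eq_mul_div, le_div_iff₀ hdenR]
    linarith

end Bounds

end Summit.CriticalPhenomena.PercolationContinuityZ3.Theorems.Pcint
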